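import Summits.BirchSwinnertonDyer.BirchSwinnertonDyer.Theorems.UniversalToricDescentPeuRamifieMultTwinResupplyAtThree
import HarnessLib

/-!
# Route `UniversalToricDescent`, act R, S_A sequel: the resupplied twin of a peu-ramifié multiplicative curve is
# GOOD ORDINARY at `3` (`a₃ ≢ 0 (mod 3)`), so the «peu-ramifié with a multiplicative twin» leaf lands in bucket A
# (good-ordinary twins: Yan–Zhu 5.7 (1), printed) BY THEOREM

Width seat `bsd-wall-utd-p2-w2` (g3). Sequel of `UniversalToricDescentPeuRamifieMultTwinResupplyAtThree.lean` (p627678,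
which closed item stmt-BirchSwinnertonDyer-27387 with a GOOD twin). `--supports stmt-BirchSwinnertonDyer-20694`. BSD is not
proved for any curve by this file.

WHY. In kernel⁗ (`ToricKernelAtThreeApZeroOddDefectPTTROfPrint`, p626132) a resupplied GOOD twin is routed by its type: good
supersingular → the `a₃ = 0` resupply → crux ♭C₀_T (research at `p = 3`); good ORDINARY → Yan–Zhu 5.7 (1), `k = 0` (bucket A,
in print). This file proves the resupplied twin is ORDINARY, so the whole peu-ramifié-with-multiplicative-twin leaf (census:
the 206 `(iv)`-bad classes, all of split type) is served by bucket A's printed inputs — a classification previously known only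
from the census's twin of record.

PROOF. Same construction as the parent file (its §1 identities are imported; the construction is re-run because the parent's
`∃` hides the witness): the integer model `M = [0, ρ, 0, (ρ² − A)/3, (ρ³ − 3Aρ − 2B)/27]` with `3 ∤ Δ(M)` has
`b₂(M) = 4ρ` with `3 ∤ ρ` (`ρ² ≡ A ≢ 0`); for every global minimal model `W″` of the member, `a₃(W″)` is the `3`-rd
coefficient of the isomorphism-invariant `L(E, s)`, i.e. `3 + 1 − #M̄(𝔽₃)` (`frobeniusTrace_eq_of_smul_eq_baseChange_int`, the
tree's `frobeniusTrace_eq_of_smul_eq_shortWeierstrass` for an arbitrary `ℤ`-model), and `a₃ ≡ A₃ = b₂ (mod 3)` (Hasse invariant,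
Silverman V.4.1 (a): `intCast_frobeniusTrace_three_eq_b₂`). Hence `3 ∤ a₃(W″)`: `GoodOrd W″ 3`.

* §1 `frobeniusTrace_eq_of_smul_eq_baseChange_int`, `intCast_frobeniusTrace_three_eq_b₂` (generic, any `ℤ`-model).
* §2 `exists_goodOrd_twin_of_mult_of_three_dvd_padicValInt` — ∀ `W′` globally minimal, `Mult W′ 3`, `3 ∣ v₃(Δ_min W′)`:
  `∃ W″` globally minimal, `W″[3] ≅ W′[3]` (`Γ_ℚ`), `GoodOrd W″ 3`.
* §3 `exists_goodOrd_twin_of_peuRamifie_mult_twin` — in the cell's currency: a curve with a peu-ramifié multiplicative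
  `3`-congruent twin has a good-ordinary `3`-congruent twin.

References: [Fisher2012Hessian] §8, Thm. 13.2; [SilvermanAEC2009] III §1, V.4.1 (a), VII.1, VII.5 Prop. 5.1, Ex. 8.19 (a);
[Kraus1989] Prop. 2; [YanZhu2026] Thm. 5.7 (1).
-/

set_option autoImplicit false
set_option linter.dupNamespace false

noncomputable section

namespace Summit.BirchSwinnertonDyer.BirchSwinnertonDyer.Theorems.UniversalToricDescentPeuRamifieResupply

open WeierstrassCurve IsDedekindDomain Rat.HeightOneSpectrum
  Literature.NumberTheory.EllipticCurves
  Literature.NumberTheory.EllipticCurves.BoxerDiao2010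
  Literature.NumberTheory.EllipticCurves.BSZLemma17
  Literature.NumberTheory.EllipticCurves.Rank1Residual
  Literature.NumberTheory.EllipticCurves.Fisher2012
  Literature.NumberTheory.Automorphic
  Summit.BirchSwinnertonDyer.Rank1Residual
  Summit.BirchSwinnertonDyer.BirchSwinnertonDyer.Theorems.UniversalToricDescentHessianTwin

/-! ## §1 `a_p` of a global minimal model through an arbitrary integer model -/

/-- **`a_p` of a global minimal model `W` equals `p + 1 − #M̄(𝔽_p)` for ANY integer model `M` of the same curve with
`p ∤ Δ(M)`** (`C • W = M ⊗ ℚ`): both are the `p`-th coefficient of the isomorphism-invariant `L(E, s)` (the tree's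
`frobeniusTrace_eq_of_smul_eq_shortWeierstrass`, for arbitrary `M`). [cite: SilvermanAEC2009, Exercise 8.19(a) with VII.1 Prop. 1.3(b)] -/
theorem frobeniusTrace_eq_of_smul_eq_baseChange_int {W : WeierstrassCurve ℚ} [W.IsElliptic] [W.IsGloballyMinimal]
    {C : VariableChange ℚ} {M : WeierstrassCurve ℤ} (h : C • W = M.baseChange ℚ) (p : ℕ) [hp : Fact p.Prime]
    (hΔ : ¬ (p : ℤ) ∣ M.Δ) : W.frobeniusTrace p = Literature.NumberTheory.Automorphic.frobeniusTrace M p := by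
  have hg : (M.baseChange ℚ).HasGoodReductionAtPrime p := hasGoodReductionAtPrime_baseChange_int_of_not_dvd_Δ M p hΔ
  have hgW : W.HasGoodReductionAtPrime p := by
    rw [← hasGoodReductionAtPrime_smul_iff W C p, h]; exact hg
  rw [← LFunction_apply_prime_eq_frobeniusTrace W p hgW, ← LFunction_smul W C, h, WeierstrassCurve.baseChange,
    algebraMap_int_eq]
  exact Literature.NumberTheory.Automorphic.lFunction_map_apply_prime_of_not_dvd _ hp.out hΔ

/-- **`a₃ ≡ b₂ (mod 3)` for an integer model with `3 ∤ Δ`**: the trace of Frobenius of `M̄/𝔽₃` is the Hasse invariant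
`A₃`, the coefficient of `x²` in `Ψ₂²(x) = 4x³ + b₂x² + 2b₄x + b₆`. [cite: SilvermanAEC2009, V.4.1 (a)] -/
theorem intCast_frobeniusTrace_three_eq_b₂ (M : WeierstrassCurve ℤ) (hΔ : ¬ (3 : ℤ) ∣ M.Δ) :
    ((Literature.NumberTheory.Automorphic.frobeniusTrace M 3 : ℤ) : ZMod 3) = (M.b₂ : ZMod 3) := by
  haveI : Fact (Nat.Prime 3) := ⟨Nat.prime_three⟩
  haveI : (M.map (Int.castRingHom (ZMod 3))).IsElliptic := by
    rw [WeierstrassCurve.isElliptic_iff, map_Δ, isUnit_iff_ne_zero, eq_intCast, ne_eq,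
      ZMod.intCast_zmod_eq_zero_iff_dvd]
    exact_mod_cast hΔ
  have h2 : ringChar (ZMod 3) ≠ 2 := by rw [ZMod.ringChar_zmod_n]; norm_num
  have key := (M.map (Int.castRingHom (ZMod 3))).cast_card_add_one_sub_natCard_point h2
  rw [ZMod.card] at key
  have hb : ((M.map (Int.castRingHom (ZMod 3))).twoTorsionPolynomial.toPoly ^ ((3 - 1) / 2)).coeff (3 - 1) =
      (M.b₂ : ZMod 3) := by
    rw [show (3 - 1) / 2 = 1 from rfl, show 3 - 1 = 2 from rfl, pow_one, Cubic.coeff_eq_b]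
    simp [WeierstrassCurve.twoTorsionPolynomial, map_b₂]
  rw [Literature.NumberTheory.Automorphic.frobeniusTrace, Literature.NumberTheory.Automorphic.numPointsMod, ← hb, ← key]

/-! ## §2 The resupplied twin is good ORDINARY -/

/-- **A multiplicative-at-`3` curve with `3 ∣ v₃(Δ_min)` (peu ramifié) has a `3`-congruent twin with GOOD ORDINARY reduction
at `3`** — a global minimal model of the Hesse-pencil member at `(−c₆ + 3^{v₃(Δ)/3}c₄ : c₄)`; construction as in the parent
file, plus `a₃ ≡ b₂ = 4ρ ≢ 0 (mod 3)`. [cite: Fisher2012Hessian, Thm. 13.2 (n = 3)] [cite: SilvermanAEC2009, V.4.1 (a) and VII.5 Prop. 5.1] -/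
theorem exists_goodOrd_twin_of_mult_of_three_dvd_padicValInt (W' : WeierstrassCurve ℚ) [W'.IsElliptic]
    [W'.IsGloballyMinimal] (hm : Mult W' 3) (hdvd : 3 ∣ padicValInt 3 W'.minimalDiscriminantInt) :
    ∃ (W'' : WeierstrassCurve ℚ) (_ : W''.IsElliptic) (_ : W''.IsGloballyMinimal),
      O6.ModPCongruent W'' W' 3 ∧ GoodOrd W'' 3 := by
  -- ### the integral invariants of `W′`
  set c₄ : ℤ := (integralModelInt W').c₄ with hc₄def
  set c₆ : ℤ := (integralModelInt W').c₆ with hc₆def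
  have hc4W : W'.c₄ = (c₄ : ℚ) := c₄_eq_intCast_c₄_integralModelInt W'
  have hc6W : W'.c₆ = (c₆ : ℚ) := c₆_eq_intCast_c₆_integralModelInt W'
  have hΔmin : W'.minimalDiscriminantInt = (integralModelInt W').Δ := rfl
  have hrel : c₄ ^ 3 - c₆ ^ 2 = 1728 * W'.minimalDiscriminantInt := by
    rw [hΔmin, (integralModelInt W').c_relation]
  have hΔ0 : W'.minimalDiscriminantInt ≠ 0 := minimalDiscriminantInt_ne_zero W'
  have hc4u : ¬ (3 : ℤ) ∣ c₄ := by
    have h := not_dvd_c₄_of_hasMultiplicativeReductionAtPrime W' 3 hm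
    exact_mod_cast h
  -- ### `n = 3n′`, `t = 3^{n′}`, `Δ_min = t³·δ` with `3 ∤ δ`
  obtain ⟨n', hn'⟩ := hdvd
  have h1 : 1 ≤ padicValInt 3 W'.minimalDiscriminantInt := one_le_padicValInt_minimalDiscriminantInt W' hm
  have hn'0 : n' ≠ 0 := by
    rintro rfl
    rw [mul_zero] at hn'
    omega
  obtain ⟨δ, hδ⟩ : ((3 : ℕ) : ℤ) ^ (3 * n') ∣ W'.minimalDiscriminantInt := by
    rw [← hn']
    exact padicValInt_dvd _
  have hδ3 : ¬ (3 : ℤ) ∣ δ := by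
    rintro ⟨δ', rfl⟩
    have h : ((3 : ℕ) : ℤ) ^ (3 * n' + 1) ∣ W'.minimalDiscriminantInt := ⟨δ', by rw [hδ]; push_cast; ring⟩
    have h' := ((padicValInt_dvd_iff (3 * n' + 1) W'.minimalDiscriminantInt).mp h).resolve_left hΔ0
    omega
  set t : ℤ := 3 ^ n' with htdef
  have ht3 : (3 : ℤ) ∣ t := dvd_pow_self 3 hn'0
  have ht0 : t ≠ 0 := pow_ne_zero _ (by norm_num)
  have hD : c₄ ^ 3 - c₆ ^ 2 = 1728 * t ^ 3 * δ := by
    rw [hrel, hδ, htdef, ← pow_mul, mul_comm n' 3]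
    push_cast
    ring
  have hc6u : ¬ (3 : ℤ) ∣ c₆ := by
    rintro ⟨x, hx⟩
    apply hc4u
    have h3 : (3 : ℤ) ∣ c₄ ^ 3 :=
      ⟨3 * x ^ 2 + 576 * t ^ 3 * δ, by linear_combination hD + (c₆ + 3 * x) * hx⟩
    exact Int.prime_three.dvd_of_dvd_pow h3
  -- ### the integers `A`, `B`, `G`
  set A : ℤ := c₄ ^ 5 - 13824 * c₄ ^ 2 * c₆ * δ + 10368 * c₄ ^ 3 * t * δ - 8957952 * c₄ * t ^ 2 * δ ^ 2 with hAdef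
  set B : ℤ := c₄ ^ 6 * c₆ + 34560 * c₄ ^ 6 * δ - 23887872 * c₄ ^ 3 * c₆ * δ ^ 2 +
        35831808 * c₄ ^ 4 * t * δ ^ 2 - 25920 * c₄ ^ 4 * c₆ * t * δ + 10368 * c₄ ^ 5 * t ^ 2 * δ +
        44789760 * c₄ ^ 2 * c₆ * t ^ 2 * δ ^ 2 - 59719680 * c₄ ^ 3 * t ^ 3 * δ ^ 2 - 5159780352 * c₆ * t ^ 3 * δ ^ 3 +
        30958682112 * c₄ * t ^ 4 * δ ^ 3 with hBdef
  set G : ℤ := -4 * c₄ ^ 3 * c₆ - 6912 * c₄ ^ 3 * δ + t * (c₄ ^ 4 + 6912 * c₄ * c₆ * δ) - 10368 * c₄ ^ 2 * t ^ 2 * δ +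
        2985984 * t ^ 3 * δ ^ 2 with hGdef
  have hA4 := hesseC4_member_eq hD
  have hB6 := hesseC6_member_eq hD
  have hG3 := hesseD_member_eq hD
  -- the syzygy `𝔠₄³ − 𝔠₆² = (c₄³ − c₆²)𝔇³` at the member, divided by `t¹²`
  have hAB : A ^ 3 - B ^ 2 = 1728 * δ * G ^ 3 := by
    rw [hAdef, hBdef, hGdef]
    linear_combination (26623333280885243904 * t ^ 6 * δ ^ 6 + 277326388342554624 * c₄ ^ 2 * t ^ 5 * δ ^ 5
      + 246512345193381888 * c₄ ^ 3 * t ^ 3 * δ ^ 5 + 570630428688384 * c₄ ^ 3 * c₆ * t ^ 3 * δ ^ 4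
      - 1150176957825024 * c₄ ^ 4 * t ^ 4 * δ ^ 4 + 1283918464548864 * c₄ ^ 5 * t ^ 2 * δ ^ 4
      - 990677827584 * c₄ ^ 5 * c₆ * t ^ 2 * δ ^ 3 + 570630428688384 * c₄ ^ 6 * δ ^ 4
      + 1135151677440 * c₄ ^ 6 * t ^ 3 * δ ^ 3 + 2641807540224 * c₄ ^ 6 * c₆ * δ ^ 3
      - 2724364025856 * c₄ ^ 7 * t * δ ^ 3 + 573308928 * c₄ ^ 7 * c₆ * t * δ ^ 2 - 385191936 * c₄ ^ 8 * t ^ 2 * δ ^ 2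
      - 1194393600 * c₄ ^ 9 * δ ^ 2 - 110592 * c₄ ^ 9 * c₆ * δ + 31104 * c₄ ^ 10 * t * δ + c₄ ^ 12) * hD
  -- ### `A`, `G` are `3`-adic units
  have hA3 : ¬ (3 : ℤ) ∣ A := by
    intro hA
    apply hc4u
    have h5 : (3 : ℤ) ∣ c₄ ^ 5 := by
      have hx : c₄ ^ 5 = A + 3 * (4608 * c₄ ^ 2 * c₆ * δ - 3456 * c₄ ^ 3 * t * δ + 2985984 * c₄ * t ^ 2 * δ ^ 2) := by
        rw [hAdef]; ring
      rw [hx]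
      exact dvd_add hA (dvd_mul_right 3 _)
    exact Int.prime_three.dvd_of_dvd_pow h5
  have hG3' : ¬ (3 : ℤ) ∣ G := by
    intro hG
    have hx : 4 * c₄ ^ 3 * c₆ = -G + t * (c₄ ^ 4 + 6912 * c₄ * c₆ * δ) +
        3 * (-2304 * c₄ ^ 3 * δ - 3456 * c₄ ^ 2 * t ^ 2 * δ + 995328 * t ^ 3 * δ ^ 2) := by
      rw [hGdef]; ring
    have h4 : (3 : ℤ) ∣ 4 * c₄ ^ 3 * c₆ := by
      rw [hx]
      exact dvd_add (dvd_add (dvd_neg.mpr hG) (dvd_mul_of_dvd_left ht3 _)) (dvd_mul_right 3 _)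
    rcases Int.prime_three.dvd_or_dvd h4 with h | h
    · rcases Int.prime_three.dvd_or_dvd h with h' | h'
      · norm_num at h'
      · exact hc4u (Int.prime_three.dvd_of_dvd_pow h')
    · exact hc6u h
  have hG0 : G ≠ 0 := fun h ↦ hG3' (h ▸ dvd_zero 3)
  -- ### `ρ` with `27 ∣ Aρ + B`; then `3 ∣ ρ² − A`, `27 ∣ ρ³ − 3Aρ − 2B`
  obtain ⟨a, b, hab⟩ := Irreducible.coprime_pow_of_not_dvd 3 Int.prime_three.irreducible hA3
  set ρ : ℤ := -(a * B) with hρdef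
  have hρ : A * ρ + B = 3 ^ 3 * (b * B) := by
    rw [hρdef]; linear_combination (-B) * hab
  have hk4' : (3 : ℤ) ^ 3 ∣ A ^ 2 * (ρ ^ 2 - A) := by
    have hx : A ^ 2 * (ρ ^ 2 - A) = (A * ρ + B) * (A * ρ - B) - 1728 * δ * G ^ 3 := by
      linear_combination (-1 : ℤ) * hAB
    rw [hx, hρ]
    exact dvd_sub (dvd_mul_of_dvd_left (dvd_mul_right _ _) _) ⟨64 * δ * G ^ 3, by ring⟩
  have h3A : (3 : ℤ) ∣ ρ ^ 2 - A := by
    have h := (dvd_pow_self (3 : ℤ) (by norm_num : (3 : ℕ) ≠ 0)).trans hk4'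
    rcases Int.prime_three.dvd_or_dvd h with h' | h'
    · exact absurd (Int.prime_three.dvd_of_dvd_pow h') hA3
    · exact h'
  have h27 : (3 : ℤ) ^ 3 ∣ ρ ^ 3 - 3 * A * ρ - 2 * B := by
    have hcop3 : IsCoprime ((3 : ℤ) ^ 3) (A ^ 3) :=
      (Irreducible.coprime_pow_of_not_dvd 3 Int.prime_three.irreducible hA3).symm.pow_right
    refine hcop3.dvd_of_dvd_mul_left ?_
    have hid : A ^ 3 * (ρ ^ 3 - 3 * A * ρ - 2 * B) =
        (A * ρ + B) * ((A * ρ + B) ^ 2 - 3 * B * (A * ρ + B) + 3 * B ^ 2 - 3 * A ^ 3) + B * (A ^ 3 - B ^ 2) := by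
      ring
    rw [hid, hρ, hAB]
    exact dvd_add (dvd_mul_of_dvd_left (dvd_mul_right _ _) _) ⟨B * (64 * δ * G ^ 3), by ring⟩
  obtain ⟨k₄, hk₄⟩ := h3A
  obtain ⟨k₆, hk₆⟩ := h27
  -- ### the integer model `M = [0, ρ, 0, k₄, k₆]`: `c₄ = 16A`, `c₆ = 64B`, `Δ = 2¹²δG³`
  set M : WeierstrassCurve ℤ := ⟨0, ρ, 0, k₄, k₆⟩ with hMdef
  have hMc4 : M.c₄ = 16 * A := by
    simp only [hMdef, WeierstrassCurve.c₄, WeierstrassCurve.b₂, WeierstrassCurve.b₄]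
    linear_combination (16 : ℤ) * hk₄
  have hMc6 : M.c₆ = 64 * B := by
    simp only [hMdef, WeierstrassCurve.c₆, WeierstrassCurve.b₂, WeierstrassCurve.b₄, WeierstrassCurve.b₆]
    linear_combination (-96 * ρ) * hk₄ + 32 * hk₆
  have hMΔ : M.Δ = 2 ^ 12 * δ * G ^ 3 := by
    have h := M.c_relation
    rw [hMc4, hMc6] at h
    have h' : (1728 : ℤ) * M.Δ = 1728 * (2 ^ 12 * δ * G ^ 3) := by
      rw [h]; linear_combination (4096 : ℤ) * hAB
    exact mul_left_cancel₀ (by norm_num) h'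
  have hMΔ3 : ¬ (3 : ℤ) ∣ M.Δ := by
    rw [hMΔ]
    intro h
    rcases Int.prime_three.dvd_or_dvd h with h1 | h1
    · rcases Int.prime_three.dvd_or_dvd h1 with h2 | h2
      · have h3 := Int.prime_three.dvd_of_dvd_pow h2
        norm_num at h3
      · exact hδ3 h2
    · exact hG3' (Int.prime_three.dvd_of_dvd_pow h1)
  -- ### the member over `ℚ` and the change of variables `(u, r) = (3t, 3t²ρ)`
  have hDq : (c₄ : ℚ) ^ 3 - (c₆ : ℚ) ^ 2 = 1728 * (t : ℚ) ^ 3 * (δ : ℚ) := by exact_mod_cast hD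
  have htq : (t : ℚ) ≠ 0 := by exact_mod_cast ht0
  have h3tq : (3 : ℚ) * (t : ℚ) ≠ 0 := mul_ne_zero (by norm_num) htq
  have hAq : ((A : ℤ) : ℚ) = (c₄ : ℚ) ^ 5 - 13824 * (c₄ : ℚ) ^ 2 * c₆ * δ + 10368 * (c₄ : ℚ) ^ 3 * t * δ -
      8957952 * (c₄ : ℚ) * t ^ 2 * δ ^ 2 := by
    rw [hAdef]; push_cast; ring
  have hBq : ((B : ℤ) : ℚ) = (c₄ : ℚ) ^ 6 * c₆ + 34560 * (c₄ : ℚ) ^ 6 * δ - 23887872 * (c₄ : ℚ) ^ 3 * c₆ * δ ^ 2 +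
      35831808 * (c₄ : ℚ) ^ 4 * t * δ ^ 2 - 25920 * (c₄ : ℚ) ^ 4 * c₆ * t * δ + 10368 * (c₄ : ℚ) ^ 5 * t ^ 2 * δ +
      44789760 * (c₄ : ℚ) ^ 2 * c₆ * t ^ 2 * δ ^ 2 - 59719680 * (c₄ : ℚ) ^ 3 * t ^ 3 * δ ^ 2 -
      5159780352 * (c₆ : ℚ) * t ^ 3 * δ ^ 3 + 30958682112 * (c₄ : ℚ) * t ^ 4 * δ ^ 3 := by
    rw [hBdef]; push_cast; ring
  have hGq : ((G : ℤ) : ℚ) = -4 * (c₄ : ℚ) ^ 3 * c₆ - 6912 * (c₄ : ℚ) ^ 3 * δ + t * ((c₄ : ℚ) ^ 4 + 6912 * c₄ * c₆ * δ) -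
      10368 * (c₄ : ℚ) ^ 2 * t ^ 2 * δ + 2985984 * (t : ℚ) ^ 3 * δ ^ 2 := by
    rw [hGdef]; push_cast; ring
  have hmem : hessePencil3 W'.c₄ W'.c₆ (-(c₆ : ℚ) + t * c₄) (c₄ : ℚ) =
      ⟨0, 0, 0, -27 * ((t : ℚ) ^ 4 * (A : ℚ)), -54 * ((t : ℚ) ^ 6 * (B : ℚ))⟩ := by
    rw [hessePencil3_eq, hc4W, hc6W, hAq, hBq]
    simp only [WeierstrassCurve.mk.injEq, true_and]
    exact ⟨by linear_combination (-27 : ℚ) * hesseC4_member_eq hDq,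
      by linear_combination (-54 : ℚ) * hesseC6_member_eq hDq⟩
  -- the member is an elliptic curve: `𝔇 = t³G ≠ 0`
  haveI hell : (hessePencil3 W'.c₄ W'.c₆ (-(c₆ : ℚ) + t * c₄) (c₄ : ℚ)).IsElliptic :=
    isElliptic_hessePencil3_of_eval_hesseD3_ne_zero W'.c₄ W'.c₆ _ _ (by
      rw [eval_hesseD3, hc4W, hc6W]
      have h := hesseD_member_eq hDq
      have h' : (-(c₆ : ℚ) + ↑t * ↑c₄) ^ 4 - 6 * ↑c₄ * (-(c₆ : ℚ) + ↑t * ↑c₄) ^ 2 * (c₄ : ℚ) ^ 2 -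
          8 * ↑c₆ * (-(c₆ : ℚ) + ↑t * ↑c₄) * (c₄ : ℚ) ^ 3 - 3 * (c₄ : ℚ) ^ 2 * (c₄ : ℚ) ^ 4 =
          (t : ℚ) ^ 3 * (G : ℚ) := by rw [hGq]; linear_combination h
      rw [h']
      exact mul_ne_zero (pow_ne_zero 3 htq) (by exact_mod_cast hG0))
  set C₁ : VariableChange ℚ := ⟨Units.mk0 ((3 : ℚ) * t) h3tq, 3 * (t : ℚ) ^ 2 * ρ, 0, 0⟩ with hC₁
  have hk₄q : (ρ : ℚ) ^ 2 - A = 3 * k₄ := by exact_mod_cast hk₄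
  have hk₆q : (ρ : ℚ) ^ 3 - 3 * A * ρ - 2 * B = 3 ^ 3 * k₆ := by exact_mod_cast hk₆
  have hkey : C₁ • hessePencil3 W'.c₄ W'.c₆ (-(c₆ : ℚ) + t * c₄) (c₄ : ℚ) = M.baseChange ℚ := by
    rw [hmem, variableChange_def, hMdef, hC₁]
    simp only [WeierstrassCurve.baseChange, WeierstrassCurve.map, Units.val_inv_eq_inv_val, Units.val_mk0,
      WeierstrassCurve.mk.injEq, algebraMap_int_eq, eq_intCast, Int.cast_zero]
    refine ⟨by ring, ?_, by ring, ?_, ?_⟩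
    · rw [inv_pow, inv_mul_eq_iff_eq_mul₀ (pow_ne_zero 2 h3tq)]
      ring
    · rw [inv_pow, inv_mul_eq_iff_eq_mul₀ (pow_ne_zero 4 h3tq)]
      linear_combination (27 * (t : ℚ) ^ 4) * hk₄q
    · rw [inv_pow, inv_mul_eq_iff_eq_mul₀ (pow_ne_zero 6 h3tq)]
      linear_combination (27 * (t : ℚ) ^ 6) * hk₆q
  -- ### a global minimal model of the member is the twin
  obtain ⟨C, hC⟩ :=
    WeierstrassCurve.hasGlobalMinimalModel_rat_holds (hessePencil3 W'.c₄ W'.c₆ (-(c₆ : ℚ) + t * c₄) (c₄ : ℚ))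
  refine ⟨C • hessePencil3 W'.c₄ W'.c₆ (-(c₆ : ℚ) + t * c₄) (c₄ : ℚ), inferInstance, hC, ?_, ?_⟩
  · -- `3`-congruence: Fisher Thm. 13.2 transported along `C`
    obtain ⟨e₁, he₁⟩ := threeCongruent_hessePencil3_unconditional W' (-(c₆ : ℚ) + t * c₄) (c₄ : ℚ)
    obtain ⟨e₂, he₂⟩ :=
      (hessePencil3 W'.c₄ W'.c₆ (-(c₆ : ℚ) + t * c₄) (c₄ : ℚ)).exists_geomTorsion_addEquiv_smul C 3
    refine ⟨e₂.symm.trans e₁, fun σ P ↦ ?_⟩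
    simp only [AddEquiv.trans_apply]
    rw [← he₁]
    congr 1
    apply e₂.injective
    rw [AddEquiv.apply_symm_apply, he₂, AddEquiv.apply_symm_apply]
  · -- good ORDINARY reduction at `3`: rescale to the integer model `M`, `3 ∤ Δ(M)`, `a₃ ≡ b₂(M) = 4ρ ≢ 0 (mod 3)`
    haveI := hC
    have hkey' : (C₁ * C⁻¹) • (C • hessePencil3 W'.c₄ W'.c₆ (-(c₆ : ℚ) + t * c₄) (c₄ : ℚ)) = M.baseChange ℚ := by
      rw [mul_smul, inv_smul_smul, hkey]
    have hgood : (C • hessePencil3 W'.c₄ W'.c₆ (-(c₆ : ℚ) + t * c₄) (c₄ : ℚ)).HasGoodReductionAtPrime 3 := by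
      rw [← hasGoodReductionAtPrime_smul_iff _ (C₁ * C⁻¹) 3, hkey']
      exact hasGoodReductionAtPrime_baseChange_int_of_not_dvd_Δ M 3 hMΔ3
    refine ⟨hgood, fun h3a ↦ ?_⟩
    have hρ3 : ¬ (3 : ℤ) ∣ ρ := by
      intro h
      apply hA3
      have hx : A = ρ ^ 2 - 3 * k₄ := by linear_combination (-1 : ℤ) * hk₄
      rw [hx]
      exact dvd_sub (dvd_pow h two_ne_zero) (dvd_mul_right 3 _)
    have hb2 : M.b₂ = 4 * ρ := by
      simp only [hMdef, WeierstrassCurve.b₂]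
      ring
    have hcast : ((Literature.NumberTheory.Automorphic.frobeniusTrace M 3 : ℤ) : ZMod 3) = 0 := by
      rw [← frobeniusTrace_eq_of_smul_eq_baseChange_int hkey' 3 hMΔ3, ZMod.intCast_zmod_eq_zero_iff_dvd]
      exact_mod_cast h3a
    rw [intCast_frobeniusTrace_three_eq_b₂ M hMΔ3, hb2, ZMod.intCast_zmod_eq_zero_iff_dvd] at hcast
    have h4ρ : (3 : ℤ) ∣ 4 * ρ := by exact_mod_cast hcast
    rcases Int.prime_three.dvd_or_dvd h4ρ with h | h
    · norm_num at h
    · exact hρ3 h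


/-! ## §3 Cell currency -/

/-- **A curve with a peu-ramifié multiplicative `3`-congruent twin has a GOOD ORDINARY `3`-congruent twin** (compose the
congruences). In kernel⁗'s trichotomy this routes the whole leaf to bucket A (printed inputs). [cite: Fisher2012Hessian, Thm. 13.2 (n = 3)] -/
theorem exists_goodOrd_twin_of_peuRamifie_mult_twin (W : WeierstrassCurve ℚ) [W.IsElliptic]
    (h : ∃ (W' : WeierstrassCurve ℚ) (_ : W'.IsElliptic) (_ : W'.IsGloballyMinimal),
      O6.ModPCongruent W' W 3 ∧ Mult W' 3 ∧ 3 ∣ padicValInt 3 W'.minimalDiscriminantInt) :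
    ∃ (W'' : WeierstrassCurve ℚ) (_ : W''.IsElliptic) (_ : W''.IsGloballyMinimal),
      O6.ModPCongruent W'' W 3 ∧ GoodOrd W'' 3 := by
  obtain ⟨W', hE', hM', hcong, hmult, hdvd⟩ := h
  haveI := hE'
  haveI := hM'
  obtain ⟨W'', e, m, hc, hg⟩ := exists_goodOrd_twin_of_mult_of_three_dvd_padicValInt W' hmult hdvd
  exact ⟨W'', e, m, modPCongruent_trans hc hcong, hg⟩

end Summit.BirchSwinnertonDyer.BirchSwinnertonDyer.Theorems.UniversalToricDescentPeuRamifieResupply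

end
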